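import Mathlib.Topology.Algebra.Valued.NormedValued
import Mathlib.NumberTheory.Padics.RingHoms
import Literature.NumberTheory.Automorphic.ThorneQInfinityModular
import Literature.NumberTheory.EllipticCurves.Curve15A1Descent
import Literature.NumberTheory.EllipticCurves.ComplexMultiplicationCoatesWilesReductionIndexProofs
import HarnessLib

/-!
# Thorne 2019, Proposition 4: the rational points of `E₁ = 15A1` and `E₂ = 15A3` (proofs)

Topic `NumberTheory/Automorphic`; sibling PROOFS file of `ThorneQInfinityModular.lean`. It
discharges the named fact

* `Literature.NumberTheory.Automorphic.Thorne2019_prop4` —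
  `Literature.NumberTheory.Automorphic.Thorne2019_prop4_holds`:
  the affine rational points of Thorne's `E₁ : y² + xy + y = x³ + x² - 10x - 10` (Cremona 15A1,
  `= X(b3, b5) = X₀(15)`) are exactly the seven of `Thorne2019.E₁Points`, and those of
  `E₂ : y² + xy + y = x³ + x² - 5x + 2` (15A3, `= X(s3, b5)`) the seven of `Thorne2019.E₂Points`;
  with `O`, `E₁(ℚ) ≅ E₂(ℚ) ≅ ℤ/2ℤ ⊕ ℤ/4ℤ`.

Source: J. A. Thorne, *Elliptic curves over `ℚ_∞` are modular*, JEMS **21** (2019),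
Proposition 4 (p. 4 of the held text, arXiv:1505.04769): "Both curves have group of rational
points isomorphic to `ℤ/2ℤ ⊕ ℤ/4ℤ`. They are related by an isogeny of degree 2. *Proof.* See
[Fre13]." — i.e. Cremona's Table 1, `N = 15`, curves `A1`, `A3` (`r = 0`, `|T| = 8`).

## Proof (all ingredients are proved results of the tree / Mathlib; no new facts)

* **`E₁`, rank zero.** `E₁(ℚ)` is finite: the tree's complete `2`-descent
  `Literature.NumberTheory.EllipticCurves.Curve15A1.finite_point` (`Curve15A1Descent.lean`,
  Silverman *AEC* X.1.4/X.1.5 with the Mordell–Weil theorem `module_finite_point_holds`).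
* **`E₁`, the `2`-part.** By the image of the `2`-descent map (`Curve15A1.descentPair_mem`: four
  classes, attained at `O`, `Q = (8, 18)`, `T₁ = (-1, 0)`, `T₁ + Q`) and its kernel `2E(ℚ)`
  (`ker_twoDescentMap`, `TwoDescent.lean`), every point lies in `⟨T₁, Q⟩ + 2E(ℚ)`.
* **`E₁`, no odd torsion** (Silverman *AEC* VII.3.1(b) at `p = 2`): the model `[1, 1, 1, -10, -10]`
  has good reduction at `2` (`Δ = 3⁴5⁴`), its reduction `y² + xy + y = x³ + x²` has exactly `4`
  points over `𝔽₂` (`natCard_point_F2`, by enumeration; transported along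
  `PadicInt.residueField` by the tree's `natCard_point_map_ringEquiv`), so the reduction
  homomorphism (tree `goodReductionHom`, `GeomPointReduction.lean`, with `ℤ₂ ⊂ ℚ₂` as valuation
  integers, `padicInt_valuationIntegers`) kills `4Q`; a point `Q` of odd order `m` then has `4Q`
  in the kernel of reduction and of order dividing `m`, `‖m‖₂ = 1`, so `4Q = O`
  (`eq_zero_of_zsmul_eq_zero_of_goodReductionHom_eq_zero`) and `Q = O` (`gcd(4, m) = 1`); this is
  transported from `E₁(ℚ₂)` to `E₁(ℚ)` along Mathlib's injective `Affine.Point.baseChange`.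
* **`E₁`, conclusion.** A finite abelian group `G` with `G = T + 2G` and no odd torsion equals `T`
  (`mem_of_forall_exists_eq_add_two_nsmul`); the eight elements of `T = ⟨T₁, Q⟩` (`2T₁ = O`,
  `4Q = O`) are computed by chord and tangent (`Curve15A1.add_self_eight`, `T₁_add_Q`, …).
* **`E₂` from `E₁`, by the degree-`2` isogeny of the Proposition** (no second descent): in the
  coordinates `X = 4x - 4`, `Y = 8y + 4x + 4`, `E₂` is the Legendre model `Y² = X(X + 1)(X + 16)`
  of `X(s3, b5)`, and `(X, Y) ↦ (Y²/X² - 25, Y(16 - X²)/X²)` (kernel `(0, 0)`) lands on the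
  Legendre model `v² = u(u + 16)(u + 25)` of `X₀(15)`, which is `E₁` in the coordinates
  `u = 4x - 12`, `v = 8y + 4x + 4` (`Thorne2019.variableChange_E₁`); so `u ∈ {-25, -20, -16, 0, 20}`
  (`u_mem_of_legendre`) and the quadratic `X² - (u + 8)X + 16 = 0` leaves the seven listed points
  (`u = ±20` would make `5` a rational square, `Curve15A1.five_ne_sq`).

## References

* [Thorne2019] J. A. Thorne, *Elliptic curves over `ℚ_∞` are modular*, J. Eur. Math. Soc. 21
  (2019), Proposition 4.
* [CremonaAlgorithms1997] J. E. Cremona, *Algorithms for Modular Elliptic Curves*, 2nd ed., CUP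
  1997: Table 1, `N = 15`, curves `A1 = [1, 1, 1, -10, -10]`, `A3 = [1, 1, 1, -5, 2]`
  (`r = 0`, `|T| = 8`).
* [SilvermanAEC2009] J. H. Silverman, *The Arithmetic of Elliptic Curves*, 2nd ed., GTM 106,
  Springer 2009: Prop. VII.3.1(b) (torsion injects into the reduction), Prop. X.1.4 (complete
  `2`-descent).

## Design

Theorems only (no definitions, no new named facts, no notation); the curves are written literally
(`⟨1, 1, 1, -10, -10⟩`, `⟨1, 1, 1, -5, 2⟩`, definitionally `Thorne2019.E₁`, `Thorne2019.E₂`).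
Group-law statements over `ℚ` are elaborated against `ℚ`'s decidable equality (the tree's
`TwoDescent.lean`, `Curve15A1Descent.lean` and Mathlib's group law are polymorphic in it); over
`ℚ₂` and the residue field the classical instances of the tree's reduction files are the only
ones. `#print axioms Thorne2019_prop4_holds`: `propext`, `Classical.choice`, `Quot.sound`.
-/

noncomputable section

open scoped Classical

open WeierstrassCurve WeierstrassCurve.Affine WeierstrassCurve.Affine.Point

namespace Literature.NumberTheory.Automorphic

namespace Thorne2019

/-! ### §A. Two group-theoretic lemmas -/

/-- **Trapping a finite abelian group by a subgroup**: if `G` is a finite abelian group, `T ≤ G`,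
every element of `G` lies in `T + 2G`, and `G` has no non-trivial element of odd order, then
`G = T`. (Iterating gives `G = T + 2ⁿG` for every `n`; writing `#G = 2ᵃ·b` with `b` odd,
`2ᵃ G = 0`.) [folklore] -/
theorem mem_of_forall_exists_eq_add_two_nsmul {G : Type*} [AddCommGroup G] [Finite G]
    (T : AddSubgroup G) (h2 : ∀ g : G, ∃ t ∈ T, ∃ h : G, g = t + 2 • h)
    (hodd : ∀ g : G, ∀ m : ℕ, Odd m → m • g = 0 → g = 0) (g : G) : g ∈ T := by
  -- `G = T + 2ⁿ G` for every `n`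
  have hpow : ∀ n : ℕ, ∀ g : G, ∃ t ∈ T, ∃ h : G, g = t + (2 ^ n) • h := by
    intro n
    induction n with
    | zero => exact fun g => ⟨0, T.zero_mem, g, by rw [pow_zero, one_nsmul, zero_add]⟩
    | succ n ih =>
      intro g
      obtain ⟨t, ht, h, rfl⟩ := ih g
      obtain ⟨t', ht', h', rfl⟩ := h2 h
      refine ⟨t + (2 ^ n) • t', T.add_mem ht (T.nsmul_mem ht' _), h', ?_⟩
      rw [nsmul_add, add_assoc, pow_succ, mul_nsmul']
  -- `#G = 2ᵃ · b` with `b` odd, and `2ᵃ • g = 0` for all `g`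
  obtain ⟨a, b, hb, hcard⟩ := Nat.exists_eq_two_pow_mul_odd (Nat.card_pos (α := G)).ne'
  have hkill : ∀ g : G, (2 ^ a) • g = 0 := fun g =>
    hodd _ b hb (by rw [← mul_nsmul, ← hcard]; exact card_nsmul_eq_zero')
  obtain ⟨t, ht, h, rfl⟩ := hpow a g
  rw [hkill, add_zero]
  exact ht

/-- **Coprime exponents kill**: if `m • g = 0` and `n • g = 0` with `m, n` coprime then `g = 0`.
[folklore] -/
theorem eq_zero_of_nsmul_eq_zero_of_coprime {G : Type*} [AddCommGroup G] {g : G} {m n : ℕ}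
    (hmn : m.Coprime n) (hm : m • g = 0) (hn : n • g = 0) : g = 0 := by
  have h₁ : addOrderOf g ∣ 1 := by
    rw [← Nat.Coprime.gcd_eq_one hmn]
    exact Nat.dvd_gcd (addOrderOf_dvd_of_nsmul_eq_zero hm) (addOrderOf_dvd_of_nsmul_eq_zero hn)
  exact AddMonoid.addOrderOf_eq_one_iff.mp (Nat.dvd_one.mp h₁)

/-- In an additive group, `m • a` only depends on `m` modulo any `k` with `k • a = 0`. [folklore] -/
theorem zsmul_eq_emod_zsmul {G : Type*} [AddCommGroup G] (a : G) {k : ℤ} (hk : k • a = 0)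
    (m : ℤ) : m • a = (m % k) • a := by
  conv_lhs => rw [← Int.emod_add_mul_ediv m k, add_zsmul, mul_zsmul', hk, zsmul_zero, add_zero]

/-! ### §B. The reduction of `E₁` modulo `2` has four points -/

/-- **`#Ẽ₁(𝔽₂) = 4`** for the reduction `y² + xy + y = x³ + x²` of 15A1 modulo `2` (`a₂ = -1`):
its nonsingular affine points are exactly `(0, 0), (0, 1), (1, 0)` (`(1, 1)` is off the curve),
plus `O` (Mathlib's `nonsingularPointEquiv`). Stated for an equation `X` *equal* to the reduced
one, for transport. [folklore] -/
theorem natCard_point_F2 (X : WeierstrassCurve (ZMod 2)) (hX : X = ⟨1, 1, 1, 0, 0⟩) :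
    Nat.card X.toAffine.Point = 4 := by
  subst hX
  have hF : ∀ a : ZMod 2, a = 0 ∨ a = 1 := by decide
  have hiff : ∀ xy : ZMod 2 × ZMod 2,
      (⟨1, 1, 1, 0, 0⟩ : WeierstrassCurve (ZMod 2)).toAffine.Nonsingular xy.1 xy.2 ↔
        xy ∈ ({(0, 0), (0, 1), (1, 0)} : Finset (ZMod 2 × ZMod 2)) := by
    rintro ⟨a, b⟩
    rw [nonsingular_iff, equation_iff]
    rcases hF a with rfl | rfl <;> rcases hF b with rfl | rfl <;> decide
  have e := (nonsingularPointEquiv (⟨1, 1, 1, 0, 0⟩ : WeierstrassCurve (ZMod 2)).toAffine).trans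
    (Equiv.subtypeEquivRight hiff).optionCongr
  rw [Nat.card_congr e, Nat.card_eq_fintype_card, Fintype.card_option, Fintype.card_coe]
  decide

/-! ### §C. No odd torsion on `E₁(ℚ₂)` by reduction modulo `2` -/

/-- **The `ℤ₂`-model of `E₁` reduces to `y² + xy + y = x³ + x²` over `𝔽₂`** (along the residue
map followed by `PadicInt.residueField : ℤ₂/2ℤ₂ ≃ ℤ/2`). [folklore] -/
theorem residueCurve_E₁ :
    ((((⟨1, 1, 1, -10, -10⟩ : WeierstrassCurve ℤ).map (Int.castRingHom ℤ_[2])).map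
        (IsLocalRing.residue ℤ_[2])).map
        (PadicInt.residueField (p := 2) : IsLocalRing.ResidueField ℤ_[2] →+* ZMod 2)) =
      ⟨1, 1, 1, 0, 0⟩ := by
  rw [WeierstrassCurve.map_map, WeierstrassCurve.map_map]
  have : (((PadicInt.residueField (p := 2) : IsLocalRing.ResidueField ℤ_[2] →+* ZMod 2).comp
      (IsLocalRing.residue ℤ_[2])).comp (Int.castRingHom ℤ_[2])) = Int.castRingHom (ZMod 2) :=
    RingHom.ext_int _ _
  rw [this]
  ext <;> simp [WeierstrassCurve.map] <;> decide

/-- **Every point of the reduction of `E₁` modulo `2` is killed by `4`**: the reduction has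
`4` points (`natCard_point_F2`, transported along `ℤ₂/2ℤ₂ ≃ 𝔽₂` by the tree's
`natCard_point_map_ringEquiv`), and `#G` kills `G`. [folklore] -/
theorem four_nsmul_eq_zero_residue
    (Q : (((⟨1, 1, 1, -10, -10⟩ : WeierstrassCurve ℤ).map (Int.castRingHom ℤ_[2])).map
      (IsLocalRing.residue ℤ_[2])).toAffine.Point) : 4 • Q = 0 := by
  have hcard : Nat.card (((⟨1, 1, 1, -10, -10⟩ : WeierstrassCurve ℤ).map
      (Int.castRingHom ℤ_[2])).map (IsLocalRing.residue ℤ_[2])).toAffine.Point = 4 := by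
    rw [← natCard_point_map_ringEquiv (PadicInt.residueField (p := 2)) _]
    exact natCard_point_F2 _ residueCurve_E₁
  rw [← hcard]
  exact card_nsmul_eq_zero'

/-- **`ℤ₂ ⊂ ℚ₂` as valuation integers** (the tree's `padicInt_valuationIntegers` at `p = 2`,
`ComplexMultiplicationCoatesWilesReductionIndexProofs`). [folklore] -/
theorem padicInt_valuationIntegers_two :
    (NormedField.valuation (K := ℚ_[2])).Integers ℤ_[2] :=
  Literature.NumberTheory.EllipticCurves.padicInt_valuationIntegers 2

/-- The `ℤ₂`-model `[1, 1, 1, -10, -10]` of 15A1 has unit discriminant `Δ = 50625 = 3⁴·5⁴`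
(good reduction at `2`). [folklore] -/
theorem isUnit_Δ_E₁_padic :
    IsUnit ((⟨1, 1, 1, -10, -10⟩ : WeierstrassCurve ℤ).map (Int.castRingHom ℤ_[2])).Δ := by
  have hΔℤ : (⟨1, 1, 1, -10, -10⟩ : WeierstrassCurve ℤ).Δ = 50625 := by
    norm_num [WeierstrassCurve.Δ, WeierstrassCurve.b₂, WeierstrassCurve.b₄, WeierstrassCurve.b₆,
      WeierstrassCurve.b₈]
  rw [map_Δ, hΔℤ, eq_intCast, PadicInt.isUnit_iff]
  refine le_antisymm (PadicInt.norm_le_one _) (not_lt.1 fun hlt => ?_)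
  have h2 : ((2 : ℕ) : ℤ) ∣ 50625 := (PadicInt.norm_int_lt_one_iff_dvd _).1 hlt
  norm_num at h2

/-- **`E₁(ℚ₂)` has no non-trivial point of odd order** (Silverman, *AEC*, VII.3.1(b) at `p = 2`
for the good-reduction model `[1, 1, 1, -10, -10]`, combined with `#Ẽ₁(𝔽₂) = 4`): if `m` is odd
and `m • Q = O` then `Q = O`. Proof: the reduction homomorphism `r` (tree `goodReductionHom`)
kills `4Q` (`four_nsmul_eq_zero_residue`), `4Q` is `m`-torsion with `‖m‖₂ = 1`, so `4Q = O`
(`eq_zero_of_zsmul_eq_zero_of_goodReductionHom_eq_zero`), and `gcd(4, m) = 1`.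
[cite: SilvermanAEC2009, Prop. VII.3.1(b)] -/
theorem eq_zero_of_odd_nsmul_eq_zero_padic
    (Q : (((⟨1, 1, 1, -10, -10⟩ : WeierstrassCurve ℤ).map (Int.castRingHom ℤ_[2])).baseChange
      ℚ_[2]).toAffine.Point) {m : ℕ} (hm : Odd m) (h : m • Q = 0) : Q = 0 := by
  -- `r (4 • Q) = 0`
  have hred : Literature.NumberTheory.EllipticCurves.goodReductionHom _
      padicInt_valuationIntegers_two isUnit_Δ_E₁_padic (4 • Q) = 0 := by
    rw [map_nsmul, four_nsmul_eq_zero_residue]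
  -- `4 • Q` is `m`-torsion, `‖m‖₂ = 1`
  have h4m : (m : ℤ) • (4 • Q) = 0 := by
    rw [natCast_zsmul, smul_comm, h, nsmul_zero]
  have hn : NormedField.valuation ((m : ℤ) : ℚ_[2]) = 1 := by
    rw [NormedField.valuation_apply, ← NNReal.coe_inj, coe_nnnorm, NNReal.coe_one]
    refine le_antisymm (Padic.norm_int_le_one _) (not_lt.1 fun hlt => ?_)
    have h2 : ((2 : ℕ) : ℤ) ∣ (m : ℤ) := Padic.norm_intCast_lt_one_iff.1 hlt
    have : 2 ∣ m := by exact_mod_cast h2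
    exact (Nat.not_even_iff_odd.mpr hm) (even_iff_two_dvd.mpr this)
  have h4 : 4 • Q = 0 :=
    Literature.NumberTheory.EllipticCurves.eq_zero_of_zsmul_eq_zero_of_goodReductionHom_eq_zero
      padicInt_valuationIntegers_two isUnit_Δ_E₁_padic hn h4m hred
  -- `gcd(4, m) = 1`
  have hcop : Nat.Coprime 4 m := by
    have h2 : Nat.Coprime 2 m := Nat.coprime_two_left.mpr hm
    simpa using h2.pow_left 2
  exact eq_zero_of_nsmul_eq_zero_of_coprime hcop h4 h

/-! ### §D. No odd torsion on `E₁(ℚ)` -/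

/-- **`E₁(ℚ)` has no non-trivial point of odd order**: transported from
`eq_zero_of_odd_nsmul_eq_zero_padic` along the injective homomorphism `E₁(ℚ) → E₁(ℚ₂)`
(Mathlib's `Affine.Point.baseChange`, read through the identifications `E₁ = E₁ℤ ⊗ ℚ` and
`E₁ℤ ⊗ ℚ₂ = (E₁ℤ ⊗ ℤ₂) ⊗ ℚ₂`, tree `Affine.Point.congrEquiv`).
[cite: SilvermanAEC2009, Prop. VII.3.1(b)] -/
theorem eq_zero_of_odd_nsmul_eq_zero_E₁
    (P : (⟨1, 1, 1, -10, -10⟩ : WeierstrassCurve ℚ).toAffine.Point) {m : ℕ} (hm : Odd m)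
    (h : m • P = 0) : P = 0 := by
  have h₁ : (⟨1, 1, 1, -10, -10⟩ : WeierstrassCurve ℚ) =
      (⟨1, 1, 1, -10, -10⟩ : WeierstrassCurve ℤ).baseChange ℚ := by
    ext <;> simp [WeierstrassCurve.baseChange, WeierstrassCurve.map]
  have h₂ : (⟨1, 1, 1, -10, -10⟩ : WeierstrassCurve ℤ).baseChange ℚ_[2] =
      ((⟨1, 1, 1, -10, -10⟩ : WeierstrassCurve ℤ).map (Int.castRingHom ℤ_[2])).baseChange
        ℚ_[2] := by
    rw [WeierstrassCurve.baseChange, WeierstrassCurve.baseChange, WeierstrassCurve.map_map]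
    exact congrArg _ (RingHom.ext_int _ _)
  set φ₁ := Affine.Point.congrEquiv h₁ with hφ₁
  set φ₂ := Affine.Point.baseChange (W' := (⟨1, 1, 1, -10, -10⟩ : WeierstrassCurve ℤ)) ℚ ℚ_[2]
    with hφ₂
  set φ₃ := Affine.Point.congrEquiv h₂ with hφ₃
  have hQ : m • φ₃ (φ₂ (φ₁ P)) = 0 := by
    rw [← map_nsmul, ← map_nsmul, ← map_nsmul, h, _root_.map_zero, _root_.map_zero,
      _root_.map_zero]
  have h0 := eq_zero_of_odd_nsmul_eq_zero_padic _ hm hQ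
  rw [← _root_.map_zero φ₃, φ₃.apply_eq_iff_eq, ← _root_.map_zero φ₂] at h0
  have h0' := Affine.Point.map_injective _ h0
  rwa [← _root_.map_zero φ₁, φ₁.apply_eq_iff_eq] at h0'

/-! ### §E. The points of `E₁`: `E₁(ℚ) = ⟨T₁, Q⟩ ≅ ℤ/2 × ℤ/4` -/

/-- `T₁ + Q = (-2, 3)` on 15A1 (`T₁ = (-1, 0)`, `Q = (8, 18)`, chord of slope `2`). [folklore] -/
theorem T₁_add_Q
    (hT : (⟨1, 1, 1, -10, -10⟩ : WeierstrassCurve ℚ).toAffine.Nonsingular (-1) 0)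
    (hQ : (⟨1, 1, 1, -10, -10⟩ : WeierstrassCurve ℚ).toAffine.Nonsingular 8 18)
    (hR : (⟨1, 1, 1, -10, -10⟩ : WeierstrassCurve ℚ).toAffine.Nonsingular (-2) 3) :
    Point.some (-1) 0 hT + Point.some 8 18 hQ = Point.some (-2) 3 hR := by
  have hx : (-1 : ℚ) ≠ 8 := by norm_num
  rw [add_of_X_ne hx]
  congr 1
  · rw [slope_of_X_ne hx]
    norm_num [addX]
  · rw [slope_of_X_ne hx]
    norm_num [addY, negAddY, addX, negY]

/-- `T₁ + 2Q = (-13/4, 9/8)` on 15A1 (`2Q = (3, -2)`, chord of slope `-1/2`). [folklore] -/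
theorem T₁_add_twoQ
    (hT : (⟨1, 1, 1, -10, -10⟩ : WeierstrassCurve ℚ).toAffine.Nonsingular (-1) 0)
    (hQ : (⟨1, 1, 1, -10, -10⟩ : WeierstrassCurve ℚ).toAffine.Nonsingular 3 (-2))
    (hR : (⟨1, 1, 1, -10, -10⟩ : WeierstrassCurve ℚ).toAffine.Nonsingular (-13 / 4) (9 / 8)) :
    Point.some (-1) 0 hT + Point.some 3 (-2) hQ = Point.some (-13 / 4) (9 / 8) hR := by
  have hx : (-1 : ℚ) ≠ 3 := by norm_num
  rw [add_of_X_ne hx]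
  congr 1
  · rw [slope_of_X_ne hx]
    norm_num [addX]
  · rw [slope_of_X_ne hx]
    norm_num [addY, negAddY, addX, negY]

/-- `T₁ + 3Q = (-2, -2)` on 15A1 (`3Q = (8, -27)`, chord of slope `-3`). [folklore] -/
theorem T₁_add_threeQ
    (hT : (⟨1, 1, 1, -10, -10⟩ : WeierstrassCurve ℚ).toAffine.Nonsingular (-1) 0)
    (hQ : (⟨1, 1, 1, -10, -10⟩ : WeierstrassCurve ℚ).toAffine.Nonsingular 8 (-27))
    (hR : (⟨1, 1, 1, -10, -10⟩ : WeierstrassCurve ℚ).toAffine.Nonsingular (-2) (-2)) :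
    Point.some (-1) 0 hT + Point.some 8 (-27) hQ = Point.some (-2) (-2) hR := by
  have hx : (-1 : ℚ) ≠ 8 := by norm_num
  rw [add_of_X_ne hx]
  congr 1
  · rw [slope_of_X_ne hx]
    norm_num [addX]
  · rw [slope_of_X_ne hx]
    norm_num [addY, negAddY, addX, negY]

/-- `2Q + Q = 3Q = (8, -27) = -Q` on 15A1 (chord of slope `4` through `(3, -2)`, `(8, 18)`).
[folklore] -/
theorem twoQ_add_Q
    (hQ₂ : (⟨1, 1, 1, -10, -10⟩ : WeierstrassCurve ℚ).toAffine.Nonsingular 3 (-2))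
    (hQ : (⟨1, 1, 1, -10, -10⟩ : WeierstrassCurve ℚ).toAffine.Nonsingular 8 18)
    (hR : (⟨1, 1, 1, -10, -10⟩ : WeierstrassCurve ℚ).toAffine.Nonsingular 8 (-27)) :
    Point.some 3 (-2) hQ₂ + Point.some 8 18 hQ = Point.some 8 (-27) hR := by
  have hx : (3 : ℚ) ≠ 8 := by norm_num
  rw [add_of_X_ne hx]
  congr 1
  · rw [slope_of_X_ne hx]
    norm_num [addX]
  · rw [slope_of_X_ne hx]
    norm_num [addY, negAddY, addX, negY]

/-- **The rational points of `E₁ = 15A1`** (Thorne 2019, Prop. 4 for `E₁ = X(b3, b5) = X₀(15)`;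
Cremona, Table 1, `N = 15`, curve `A1`: `E(ℚ) ≅ ℤ/2ℤ × ℤ/4ℤ`): every affine rational point is one
of the seven of `Thorne2019.E₁Points`. Proof: `E(ℚ)` is finite (rank `0` by the tree's complete
`2`-descent `Curve15A1.finite_point` and the Mordell–Weil theorem); by the image of the `2`-descent
map (`Curve15A1.descentPair_mem`, kernel `2E(ℚ)`) every point lies in `{O, Q, T₁, T₁ + Q} + 2E(ℚ)`
(`T₁ = (-1, 0)`, `Q = (8, 18)`); `E(ℚ)` has no odd torsion (`eq_zero_of_odd_nsmul_eq_zero_E₁`,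
reduction modulo `2`); hence `E(ℚ) = ⟨T₁, Q⟩` (`mem_of_forall_exists_eq_add_two_nsmul`), whose
eight elements are listed by the chord-and-tangent computations above.
[cite: Thorne2019, Prop. 4] [cite: CremonaAlgorithms1997, Table 1, N = 15, curve A1] -/
theorem mem_E₁Points_of_equation {x y : ℚ}
    (hxy : (⟨1, 1, 1, -10, -10⟩ : WeierstrassCurve ℚ).toAffine.Equation x y) :
    (x, y) ∈ E₁Points := by
  -- `Δ = 50625 ≠ 0`
  haveI hE : (⟨1, 1, 1, -10, -10⟩ : WeierstrassCurve ℚ).IsElliptic :=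
    ⟨by
      rw [show (⟨1, 1, 1, -10, -10⟩ : WeierstrassCurve ℚ).Δ = 50625 by
        norm_num [WeierstrassCurve.Δ, b₂, b₄, b₆, b₈]]
      norm_num⟩
  haveI : Finite (⟨1, 1, 1, -10, -10⟩ : WeierstrassCurve ℚ).toAffine.Point :=
    Literature.NumberTheory.EllipticCurves.Curve15A1.finite_point
  have hns : ∀ {a b : ℚ}, (⟨1, 1, 1, -10, -10⟩ : WeierstrassCurve ℚ).toAffine.Equation a b →
      (⟨1, 1, 1, -10, -10⟩ : WeierstrassCurve ℚ).toAffine.Nonsingular a b :=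
    fun hab => equation_iff_nonsingular.mp hab
  have heq : ∀ {a b : ℚ}, b ^ 2 + a * b + b = a ^ 3 + a ^ 2 - 10 * a - 10 →
      (⟨1, 1, 1, -10, -10⟩ : WeierstrassCurve ℚ).toAffine.Nonsingular a b :=
    fun hab => hns (Literature.NumberTheory.EllipticCurves.Curve15A1.equation_of_eq hab)
  have hT₁ := heq (a := -1) (b := 0) (by norm_num)
  have hQ := heq (a := 8) (b := 18) (by norm_num)
  have hQ₂ := heq (a := 3) (b := -2) (by norm_num)
  have hQ₃ := heq (a := 8) (b := -27) (by norm_num)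
  have hR₁ := heq (a := -2) (b := 3) (by norm_num)
  have hR₂ := heq (a := -13 / 4) (b := 9 / 8) (by norm_num)
  have hR₃ := heq (a := -2) (b := -2) (by norm_num)
  set T₁ := Point.some (-1) 0 hT₁ with hT₁def
  set Q := Point.some 8 18 hQ with hQdef
  -- orders: `2T₁ = 0`, `4Q = 0`
  have h2T₁ : T₁ + T₁ = 0 := add_self_of_Y_eq (by norm_num [negY])
  have h2Q : Q + Q = Point.some 3 (-2) hQ₂ :=
    Literature.NumberTheory.EllipticCurves.Curve15A1.add_self_eight hQ hQ₂
  have h3Q : Q + Q + Q = Point.some 8 (-27) hQ₃ := by rw [h2Q, twoQ_add_Q hQ₂ hQ hQ₃]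
  have h4Q : Q + Q + Q + Q = 0 := by
    rw [add_assoc, h2Q]
    exact add_self_of_Y_eq (by norm_num [negY])
  -- the `2`-descent map and its values at `T₁`, `Q`
  have h := Literature.NumberTheory.EllipticCurves.Curve15A1.splitTwoTorsion
  set ψ := twoDescentMap h with hψ
  have hψT₁ : ψ T₁ = Additive.ofMul (sqClass (-1 : ℚ), sqClass (-1 : ℚ)) := by
    rw [hψ, twoDescentMap_apply, twoDescentComponent_some_of_eq hT₁ rfl,
      twoDescentComponent_some_of_ne hT₁ (by norm_num),
      show ((-1 : ℚ) - 3) * (-1 - (-13 / 4)) = -1 * 3 ^ 2 by norm_num,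
      show (-1 : ℚ) - 3 = -1 * 2 ^ 2 by norm_num,
      Literature.NumberTheory.EllipticCurves.Curve24A1.sqClass_mul_sq (by norm_num) (by norm_num),
      Literature.NumberTheory.EllipticCurves.Curve24A1.sqClass_mul_sq (by norm_num) (by norm_num)]
  have hψQ : ψ Q = Additive.ofMul ((1 : SqUnits ℚ), sqClass (5 : ℚ)) := by
    rw [hψ, twoDescentMap_apply, twoDescentComponent_some_of_ne hQ (by norm_num),
      twoDescentComponent_some_of_ne hQ (by norm_num),
      show (8 : ℚ) - (-1) = 3 ^ 2 by norm_num, show (8 : ℚ) - 3 = 5 by norm_num, sqClass_sq]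
  have hψTQ : ψ (T₁ + Q) = Additive.ofMul (sqClass (-1 : ℚ), sqClass (-5 : ℚ)) := by
    rw [map_add, hψT₁, hψQ, ← ofMul_mul, Prod.mk_mul_mk, SqUnits.mul_one,
      show (-5 : ℚ) = -1 * 5 by norm_num, sqClass_mul (by norm_num) (by norm_num)]
  -- `ψ P = ψ t ⟹ P ∈ t + 2E(ℚ)`
  have hdiv : ∀ P t : (⟨1, 1, 1, -10, -10⟩ : WeierstrassCurve ℚ).toAffine.Point,
      ψ P = ψ t → ∃ g, P = t + 2 • g := fun P t hPt => by
    have hker : P - t ∈ ψ.ker := by rw [AddMonoidHom.mem_ker, map_sub, hPt, sub_self]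
    rw [hψ, ker_twoDescentMap h] at hker
    obtain ⟨g, hg⟩ := hker
    exact ⟨g, by rw [nsmulAddMonoidHom_apply] at hg; rw [hg, add_sub_cancel]⟩
  -- the subgroup `⟨T₁, Q⟩`
  set T : AddSubgroup (⟨1, 1, 1, -10, -10⟩ : WeierstrassCurve ℚ).toAffine.Point :=
    AddSubgroup.closure {T₁, Q} with hTdef
  have hT₁T : T₁ ∈ T := AddSubgroup.subset_closure (Set.mem_insert _ _)
  have hQT : Q ∈ T := AddSubgroup.subset_closure (Set.mem_insert_of_mem _ rfl)
  -- every point lies in `T + 2E(ℚ)`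
  have h2 : ∀ P : (⟨1, 1, 1, -10, -10⟩ : WeierstrassCurve ℚ).toAffine.Point,
      ∃ t ∈ T, ∃ g, P = t + 2 • g := by
    intro P
    have hmem := Literature.NumberTheory.EllipticCurves.Curve15A1.descentPair_mem P
    have hψP : ψ P = Additive.ofMul
        (twoDescentComponent (⟨1, 1, 1, -10, -10⟩ : WeierstrassCurve ℚ).toAffine (-1) 3 (-13 / 4) P,
          twoDescentComponent (⟨1, 1, 1, -10, -10⟩ : WeierstrassCurve ℚ).toAffine 3 (-1) (-13 / 4)
            P) := by
      rw [hψ, twoDescentMap_apply]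
    simp only [Set.mem_insert_iff, Set.mem_singleton_iff] at hmem
    rcases hmem with hc | hc | hc | hc <;> rw [hc] at hψP
    · obtain ⟨g, hg⟩ := hdiv P 0 (by rw [hψP, _root_.map_zero]; rfl)
      exact ⟨0, T.zero_mem, g, hg⟩
    · obtain ⟨g, hg⟩ := hdiv P Q (by rw [hψP, hψQ])
      exact ⟨Q, hQT, g, hg⟩
    · obtain ⟨g, hg⟩ := hdiv P T₁ (by rw [hψP, hψT₁])
      exact ⟨T₁, hT₁T, g, hg⟩
    · obtain ⟨g, hg⟩ := hdiv P (T₁ + Q) (by rw [hψP, hψTQ])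
      exact ⟨T₁ + Q, T.add_mem hT₁T hQT, g, hg⟩
  -- no odd torsion, hence `E(ℚ) = T`
  have hodd : ∀ P : (⟨1, 1, 1, -10, -10⟩ : WeierstrassCurve ℚ).toAffine.Point, ∀ m : ℕ,
      Odd m → m • P = 0 → P = 0 := fun P m hm hP => eq_zero_of_odd_nsmul_eq_zero_E₁ P hm hP
  have hP : Point.some x y (hns hxy) ∈ T := mem_of_forall_exists_eq_add_two_nsmul T h2 hodd _
  -- enumerate `T = {m T₁ + n Q}`
  rw [hTdef, AddSubgroup.mem_closure_pair] at hP
  obtain ⟨m, n, hmn⟩ := hP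
  have h2T₁' : (2 : ℤ) • T₁ = 0 := by rw [two_zsmul, h2T₁]
  have h4Q' : (4 : ℤ) • Q = 0 := by
    rw [show (4 : ℤ) = 1 + 1 + 1 + 1 by norm_num, add_zsmul, add_zsmul, add_zsmul, one_zsmul, h4Q]
  rw [zsmul_eq_emod_zsmul T₁ h2T₁' m, zsmul_eq_emod_zsmul Q h4Q' n] at hmn
  have hm2 : m % 2 = 0 ∨ m % 2 = 1 := Int.emod_two_eq_zero_or_one m
  have hn4 : n % 4 = 0 ∨ n % 4 = 1 ∨ n % 4 = 2 ∨ n % 4 = 3 := by omega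
  have e2 : (2 : ℤ) • Q = Point.some 3 (-2) hQ₂ := by rw [two_zsmul, h2Q]
  have e3 : (3 : ℤ) • Q = Point.some 8 (-27) hQ₃ := by
    rw [show (3 : ℤ) = 1 + 1 + 1 by norm_num, add_zsmul, add_zsmul, one_zsmul, h3Q]
  simp only [E₁Points, Set.mem_insert_iff, Set.mem_singleton_iff, Prod.mk.injEq]
  rcases hm2 with hm | hm <;> rcases hn4 with hn | hn | hn | hn <;> rw [hm, hn] at hmn
  · -- `O`
    rw [zero_zsmul, zero_zsmul, add_zero] at hmn
    exact absurd hmn.symm (some_ne_zero _)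
  · -- `Q = (8, 18)`
    rw [zero_zsmul, one_zsmul, zero_add, hQdef] at hmn
    obtain ⟨rfl, rfl⟩ := some.inj hmn
    norm_num
  · -- `2Q = (3, -2)`
    rw [zero_zsmul, e2, zero_add] at hmn
    obtain ⟨rfl, rfl⟩ := some.inj hmn
    norm_num
  · -- `3Q = (8, -27)`
    rw [zero_zsmul, e3, zero_add] at hmn
    obtain ⟨rfl, rfl⟩ := some.inj hmn
    norm_num
  · -- `T₁ = (-1, 0)`
    rw [one_zsmul, zero_zsmul, add_zero, hT₁def] at hmn
    obtain ⟨rfl, rfl⟩ := some.inj hmn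
    norm_num
  · -- `T₁ + Q = (-2, 3)`
    rw [one_zsmul, one_zsmul, hT₁def, hQdef, T₁_add_Q hT₁ hQ hR₁] at hmn
    obtain ⟨rfl, rfl⟩ := some.inj hmn
    norm_num
  · -- `T₁ + 2Q = (-13/4, 9/8)`
    rw [one_zsmul, e2, hT₁def, T₁_add_twoQ hT₁ hQ₂ hR₂] at hmn
    obtain ⟨rfl, rfl⟩ := some.inj hmn
    norm_num
  · -- `T₁ + 3Q = (-2, -2)`
    rw [one_zsmul, e3, hT₁def, T₁_add_threeQ hT₁ hQ₃ hR₃] at hmn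
    obtain ⟨rfl, rfl⟩ := some.inj hmn
    norm_num

/-! ### §F. The points of `E₂` from those of `E₁`, by the explicit `2`-isogeny -/

/-- **The rational points of `X₀(15)` in Legendre form** `v² = u(u + 16)(u + 25)`
(the tree's `X0FifteenLegendre`, `ℚ`-isomorphic to `E₁` by `u = 4x - 12`, `v = 8y + 4x + 4`,
`Thorne2019.variableChange_E₁`): the `u`-coordinate of an affine rational point is
`-25, -20, -16, 0` or `20`. [cite: Thorne2019, Prop. 4] -/
theorem u_mem_of_legendre {u v : ℚ} (h : v ^ 2 = u * (u + 16) * (u + 25)) :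
    u = -25 ∨ u = -20 ∨ u = -16 ∨ u = 0 ∨ u = 20 := by
  have key : (⟨1, 1, 1, -10, -10⟩ : WeierstrassCurve ℚ).toAffine.Equation ((u + 12) / 4)
      ((v - u - 16) / 8) := by
    refine Literature.NumberTheory.EllipticCurves.Curve15A1.equation_of_eq ?_
    linear_combination h / 64
  have hmem := mem_E₁Points_of_equation key
  simp only [E₁Points, Set.mem_insert_iff, Set.mem_singleton_iff, Prod.mk.injEq] at hmem
  rcases hmem with ⟨h1, -⟩ | ⟨h1, -⟩ | ⟨h1, -⟩ | ⟨h1, -⟩ | ⟨h1, -⟩ | ⟨h1, -⟩ | ⟨h1, -⟩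
  · exact Or.inl (by linarith)
  · exact Or.inr (Or.inl (by linarith))
  · exact Or.inr (Or.inl (by linarith))
  · exact Or.inr (Or.inr (Or.inl (by linarith)))
  · exact Or.inr (Or.inr (Or.inr (Or.inl (by linarith))))
  · exact Or.inr (Or.inr (Or.inr (Or.inr (by linarith))))
  · exact Or.inr (Or.inr (Or.inr (Or.inr (by linarith))))

/-- **The rational points of the Legendre model `Y² = X(X + 1)(X + 16)` of `X(s3, b5)`**
(`ℚ`-isomorphic to `E₂ = 15A3` by `X = 4x - 4`, `Y = 8y + 4x + 4`): the affine rational points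
are `(0, 0), (-1, 0), (-16, 0), (-4, ±12), (4, ±20)`. Proof, without a second descent: the
`2`-isogeny with kernel `(0, 0)`, `(X, Y) ↦ (u, v) = (Y²/X² - 25, Y(16 - X²)/X²)`, lands on the
Legendre model `v² = u(u + 16)(u + 25)` of `X₀(15) ≅ E₁`; so `u ∈ {-25, -20, -16, 0, 20}`
(`u_mem_of_legendre`), i.e. `Y² = (u + 25)X²`, and with the curve equation
`X² - (u + 8)X + 16 = 0`; for `u = -20, 20` this quadratic would make `5` a rational square
(`Curve15A1.five_ne_sq`), and `u = -25, -16, 0` give `X ∈ {-1, -16}, {-4}, {4}`.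
[cite: Thorne2019, Prop. 4] -/
theorem legendre_Xs3b5_points {X Y : ℚ} (hL : Y ^ 2 = X * (X + 1) * (X + 16)) :
    (X = 0 ∧ Y = 0) ∨ (X = -1 ∧ Y = 0) ∨ (X = -16 ∧ Y = 0) ∨ (X = -4 ∧ (Y = 12 ∨ Y = -12)) ∨
      (X = 4 ∧ (Y = 20 ∨ Y = -20)) := by
  by_cases hX : X = 0
  · subst hX
    have h0 : Y ^ 2 = 0 := by linear_combination hL
    exact Or.inl ⟨rfl, (pow_eq_zero_iff two_ne_zero).mp h0⟩
  right
  have hX2 : X ^ 2 ≠ 0 := pow_ne_zero 2 hX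
  -- the isogenous point `(u, v)` lies on `v² = u(u + 16)(u + 25)`
  have hiso : X ^ 2 * Y ^ 2 * (16 - X ^ 2) ^ 2 =
      (Y ^ 2 - 25 * X ^ 2) * (Y ^ 2 - 9 * X ^ 2) * Y ^ 2 := by
    linear_combination (-(Y ^ 2) * (2 * X ^ 3 + 32 * X + Y ^ 2 - X * (X + 1) * (X + 16))) * hL
  have huv : (Y * (16 - X ^ 2) / X ^ 2) ^ 2 =
      (Y ^ 2 / X ^ 2 - 25) * ((Y ^ 2 / X ^ 2 - 25) + 16) * ((Y ^ 2 / X ^ 2 - 25) + 25) := by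
    field_simp
    linear_combination hiso
  -- so `Y² = (u + 25) X²` with `u ∈ {-25, -20, -16, 0, 20}`, and `(u + 25) X = (X + 1)(X + 16)`
  have hquad : ∀ c : ℚ, Y ^ 2 / X ^ 2 - 25 = c → Y ^ 2 = (c + 25) * X ^ 2 ∧
      (X + 1) * (X + 16) - (c + 25) * X = 0 := by
    intro c hu
    rw [sub_eq_iff_eq_add, div_eq_iff hX2] at hu
    refine ⟨hu, ?_⟩
    have h1 : X * ((X + 1) * (X + 16) - (c + 25) * X) = 0 := by linear_combination hu - hL
    exact (mul_eq_zero.mp h1).resolve_left hX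
  rcases u_mem_of_legendre huv with hu | hu | hu | hu | hu <;> obtain ⟨hY, hq⟩ := hquad _ hu
  · -- `u = -25`: `Y = 0`, `(X + 1)(X + 16) = 0`
    have hY0 : Y = 0 := (pow_eq_zero_iff two_ne_zero).mp (by linear_combination hY)
    have hprod : (X + 1) * (X + 16) = 0 := by linear_combination hq
    rcases mul_eq_zero.mp hprod with h1 | h1
    · exact Or.inl ⟨by linarith, hY0⟩
    · exact Or.inr (Or.inl ⟨by linarith, hY0⟩)
  · -- `u = -20`: `X² + 12X + 16 = 0`, `5 = ((X + 6)/2)²`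
    exfalso
    refine Literature.NumberTheory.EllipticCurves.Curve15A1.five_ne_sq ((X + 6) / 2) ?_
    linear_combination (-1 / 4 : ℚ) * hq
  · -- `u = -16`: `(X + 4)² = 0`, `Y² = 144`
    have hX4 : X = -4 := by
      have h0 : (X + 4) ^ 2 = 0 := by linear_combination hq
      linarith [(pow_eq_zero_iff two_ne_zero).mp h0]
    subst hX4
    have hY2 : (Y - 12) * (Y + 12) = 0 := by linear_combination hY
    refine Or.inr (Or.inr (Or.inl ⟨rfl, ?_⟩))
    rcases mul_eq_zero.mp hY2 with h1 | h1
    · exact Or.inl (by linarith)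
    · exact Or.inr (by linarith)
  · -- `u = 0`: `(X - 4)² = 0`, `Y² = 400`
    have hX4 : X = 4 := by
      have h0 : (X - 4) ^ 2 = 0 := by linear_combination hq
      linarith [(pow_eq_zero_iff two_ne_zero).mp h0]
    subst hX4
    have hY2 : (Y - 20) * (Y + 20) = 0 := by linear_combination hY
    refine Or.inr (Or.inr (Or.inr ⟨rfl, ?_⟩))
    rcases mul_eq_zero.mp hY2 with h1 | h1
    · exact Or.inl (by linarith)
    · exact Or.inr (by linarith)
  · -- `u = 20`: `X² - 28X + 16 = 0`, `5 = ((X - 14)/6)²`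
    exfalso
    refine Literature.NumberTheory.EllipticCurves.Curve15A1.five_ne_sq ((X - 14) / 6) ?_
    linear_combination (-1 / 36 : ℚ) * hq

/-- **The rational points of `E₂ = 15A3`** (Thorne 2019, Prop. 4 for `E₂ = X(s3, b5)`; Cremona,
Table 1, `N = 15`, curve `A3`: `E(ℚ) ≅ ℤ/2ℤ × ℤ/4ℤ`): every affine rational point is one of the
seven of `Thorne2019.E₂Points` — read off from `legendre_Xs3b5_points` in the coordinates
`X = 4x - 4`, `Y = 8y + 4x + 4`.
[cite: Thorne2019, Prop. 4] [cite: CremonaAlgorithms1997, Table 1, N = 15, curve A3] -/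
theorem mem_E₂Points_of_equation {x y : ℚ}
    (hxy : (⟨1, 1, 1, -5, 2⟩ : WeierstrassCurve ℚ).toAffine.Equation x y) :
    (x, y) ∈ E₂Points := by
  rw [equation_iff] at hxy
  have hL : (8 * y + 4 * x + 4) ^ 2 = (4 * x - 4) * ((4 * x - 4) + 1) * ((4 * x - 4) + 16) := by
    linear_combination 64 * hxy
  simp only [E₂Points, Set.mem_insert_iff, Set.mem_singleton_iff, Prod.mk.injEq]
  rcases legendre_Xs3b5_points hL with ⟨h1, h2⟩ | ⟨h1, h2⟩ | ⟨h1, h2⟩ | ⟨h1, h2 | h2⟩ |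
    ⟨h1, h2 | h2⟩
  · -- `(1, -1)`
    have hx : x = 1 := by linarith
    have hy : y = -1 := by subst hx; linarith
    subst hx hy; norm_num
  · -- `(3/4, -7/8)`
    have hx : x = 3 / 4 := by linarith
    have hy : y = -7 / 8 := by subst hx; linarith
    subst hx hy; norm_num
  · -- `(-3, 1)`
    have hx : x = -3 := by linarith
    have hy : y = 1 := by subst hx; linarith
    subst hx hy; norm_num
  · -- `(0, 1)`
    have hx : x = 0 := by linarith
    have hy : y = 1 := by subst hx; linarith
    subst hx hy; norm_num
  · -- `(0, -2)`
    have hx : x = 0 := by linarith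
    have hy : y = -2 := by subst hx; linarith
    subst hx hy; norm_num
  · -- `(2, 1)`
    have hx : x = 2 := by linarith
    have hy : y = 1 := by subst hx; linarith
    subst hx hy; norm_num
  · -- `(2, -4)`
    have hx : x = 2 := by linarith
    have hy : y = -4 := by subst hx; linarith
    subst hx hy; norm_num

/-! ### §G. Proposition 4 -/

/-- **Thorne 2019, Proposition 4 (the rational points of `E₁ = X(b3, b5)` and `E₂ = X(s3, b5)`),
proved**: discharge of the named fact `Thorne2019_prop4` — the affine rational points of `E₁`
(15A1) are exactly the seven of `Thorne2019.E₁Points` and those of `E₂` (15A3) the seven of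
`Thorne2019.E₂Points`, i.e. `E₁(ℚ) ≅ E₂(ℚ) ≅ ℤ/2ℤ ⊕ ℤ/4ℤ` (`mem_E₁Points_of_equation`: Mordell–Weil
rank `0` by the tree's complete `2`-descent + no odd torsion by reduction modulo `2` + the image of
the `2`-descent map; `mem_E₂Points_of_equation`: transported along the explicit `2`-isogeny
`X(s3, b5) → X₀(15)`). [cite: Thorne2019, Prop. 4]
[cite: CremonaAlgorithms1997, Table 1, N = 15, curves A1 and A3] -/
theorem _root_.Literature.NumberTheory.Automorphic.Thorne2019_prop4_holds : Thorne2019_prop4 :=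
  ⟨fun _ _ h => mem_E₁Points_of_equation h, fun _ _ h => mem_E₂Points_of_equation h⟩

end Thorne2019

end Literature.NumberTheory.Automorphic

end
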